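import Summits.QuantumAdvantage.QuantumAdvantage.Theorems.ArithStatLadderEndJuntaRungCharacters
import Literature.NumberTheory.QuadraticFields.ThreeTorsionMeanProgressionProofs
import Literature.NumberTheory.QuadraticFields.ThreeTorsionMeanLemma21Sets

/-!
# `EndJuntaRung` (stmt-QuantumAdvantage-2426) — counting in the `2`-adic types (Lemma 21 bookkeeping)

Route `ArithStatLadder`, support item `EndJuntaRung`. The eight completions `ℚ(√D) ⊗ ℚ₂` are the
classes `D ≡ r s (mod 8r)`, `r ∈ {1, 4, 8}`, `s ∈ {1, 3, 5, 7}`, `e(rs, 2) = 1` (`ttLocalFactorTwo`;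
the types of Taniguchi–Thorne 2013 at the prime `2`). With Taniguchi–Thorne's Lemma 21 PROVED in the
tree (`tt_count_quadraticFields_progression_holds`) this file proves, unconditionally:

* `filter_modEq_mul_eq_filter_type` — a class `r b (mod r 2ʲ)` (`b ≡ s (mod 8)`, `j ≥ 3`) is the part
  of the type `(r, s)` where `D/r ≡ b (mod 2ʲ)`;
* `abs_card_type_filter_sub_le`, `abs_card_type_sub_le` — such a class holds `8X/(π² 2ᵏ) + O(√X)`
  negative fundamental discriminants (`r 2ʲ = 2ᵏ`, `k ≥ 6`), and the whole type `X/(r π²) + O(√X)`;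
* `norm_sum_char_type_le` — for a character `χ (mod 2ʲ)` NOT trivial on the residues `≡ 1 (mod 8)`,
  the character sum `Σ_{D of type (r,s), |D| < X} χ(D/r)` is `O(√X)` (uniform counts in the fibre of
  `ZMod 2ʲ → ZMod 8` over `s`, on which `χ` sums to zero).
-/

noncomputable section

set_option linter.dupNamespace false -- D-0017: single-problem summit ⇒ `QuantumAdvantage.QuantumAdvantage` by design

namespace Summit.QuantumAdvantage.QuantumAdvantage.Theorems.ArithStatLadder

open Finset
open Literature.NumberTheory.QuadraticFields

/-! ## The `2`-adic types `D ≡ r s (mod 8r)` -/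

/-- Arithmetic of a type: `0 < r`, `s` odd, `8r ∣ 64`, and `r = 2ᵛ` with `v ≤ 3`. -/
theorem type_arith {r : ℕ} {s : ℤ} (hr : r ∈ ({1, 4, 8} : Finset ℕ))
    (hs : s ∈ ({1, 3, 5, 7} : Finset ℤ)) :
    0 < r ∧ s % 2 = 1 ∧ 8 * r ∣ 64 ∧ ∃ v : ℕ, v ≤ 3 ∧ r = 2 ^ v := by
  simp only [Finset.mem_insert, Finset.mem_singleton] at hr hs
  refine ⟨by rcases hr with rfl | rfl | rfl <;> norm_num,
    by rcases hs with rfl | rfl | rfl | rfl <;> norm_num,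
    by rcases hr with rfl | rfl | rfl <;> norm_num, ?_⟩
  rcases hr with rfl | rfl | rfl
  · exact ⟨0, by norm_num, by norm_num⟩
  · exact ⟨2, by norm_num, by norm_num⟩
  · exact ⟨3, le_rfl, by norm_num⟩

/-- For an admissible type `(r, s)` and `b ≡ s (mod 8)`: the class `r b` is admissible for Lemma 21,
`e(r b, 2) = 1` (`r b ≡ 1 (mod 4)` or `≡ 8, 12 (mod 16)`). -/
theorem ttLocalFactorTwo_mul_eq_one_of_modEq {r : ℕ} {s : ℤ} (hr : r ∈ ({1, 4, 8} : Finset ℕ))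
    (hs : s ∈ ({1, 3, 5, 7} : Finset ℤ)) (he : ttLocalFactorTwo (r * s) = 1) {b : ℤ}
    (hb : b ≡ s [ZMOD 8]) : ttLocalFactorTwo (r * b) = 1 := by
  rw [Int.ModEq] at hb
  simp only [Finset.mem_insert, Finset.mem_singleton] at hr hs
  unfold ttLocalFactorTwo at he ⊢
  split_ifs at he with h1
  · rw [if_pos]
    rcases hr with rfl | rfl | rfl <;> rcases hs with rfl | rfl | rfl | rfl <;>
      push_cast at h1 hb ⊢ <;> first | omega | (exfalso; simp at h1)
  · exact absurd he (by norm_num)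

/-- From `r 2ʲ = 2ᵏ`, `k ≥ 6`, `r ∈ {1, 4, 8}`: `3 ≤ j`. -/
theorem three_le_of_mul_two_pow_eq {r j k : ℕ} (hr : r ∈ ({1, 4, 8} : Finset ℕ)) (hk : 6 ≤ k)
    (hrj : r * 2 ^ j = 2 ^ k) : 3 ≤ j := by
  by_contra hj
  have h1 : r * 2 ^ j ≤ 8 * 2 ^ 2 := by
    refine Nat.mul_le_mul ?_ (Nat.pow_le_pow_right two_pos (by omega))
    simp only [Finset.mem_insert, Finset.mem_singleton] at hr
    omega
  have h2 : 2 ^ 6 ≤ 2 ^ k := Nat.pow_le_pow_right two_pos hk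
  omega

/-- **A class `mod r·2ʲ` inside its `2`-adic type.** For `0 < r`, `3 ≤ j` and `b ≡ s (mod 8)`:
`{D ∈ S : D ≡ r b (mod r 2ʲ)} = {D ∈ S : D ≡ r s (mod 8r), D/r ≡ b (mod 2ʲ)}`. -/
theorem filter_modEq_mul_eq_filter_type {r : ℕ} (hr : 0 < r) (s : ℤ) {j : ℕ} (hj : 3 ≤ j)
    {b : ℤ} (hb : b ≡ s [ZMOD 8]) (S : Finset ℤ) :
    S.filter (fun D => D ≡ r * b [ZMOD ((r * 2 ^ j : ℕ) : ℤ)]) =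
      (S.filter (fun D => D ≡ r * s [ZMOD ((8 * r : ℕ) : ℤ)])).filter
        (fun D => D / r ≡ b [ZMOD ((2 ^ j : ℕ) : ℤ)]) := by
  have hr0 : (r:ℤ) ≠ 0 := by exact_mod_cast hr.ne'
  have h8 : (8:ℤ) ∣ 2 ^ j := by
    rw [show (8:ℤ) = 2 ^ 3 by norm_num]; exact pow_dvd_pow 2 hj
  ext D
  simp only [Finset.mem_filter, and_assoc, and_congr_right_iff]
  intro _
  push_cast
  constructor
  · intro h
    obtain ⟨t, ht⟩ := Int.modEq_iff_dvd.mp h.symm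
    have hD : D = r * (b + 2 ^ j * t) := by linear_combination ht
    have hDr : D / r = b + 2 ^ j * t := by rw [hD]; exact Int.mul_ediv_cancel_left _ hr0
    refine ⟨?_, ?_⟩
    · rw [Int.modEq_iff_dvd, hD]
      obtain ⟨e, he⟩ := Int.modEq_iff_dvd.mp hb
      obtain ⟨f, hf⟩ := h8
      exact ⟨e - f * t, by rw [hf]; linear_combination (r:ℤ) * he⟩
    · rw [hDr, Int.modEq_iff_dvd]
      exact ⟨-t, by ring⟩
  · rintro ⟨h1, h2⟩
    have hrD : (r:ℤ) ∣ D := by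
      obtain ⟨t, ht⟩ := Int.modEq_iff_dvd.mp h1.symm
      exact ⟨s + 8 * t, by linear_combination ht⟩
    obtain ⟨D', rfl⟩ := hrD
    rw [Int.mul_ediv_cancel_left _ hr0] at h2
    obtain ⟨t, ht⟩ := Int.modEq_iff_dvd.mp h2
    rw [Int.modEq_iff_dvd]
    exact ⟨t, by linear_combination (r:ℤ) * ht⟩

/-- On a type, `D/r ≡ s (mod 8)`. -/
theorem ediv_modEq_of_mem_type {r : ℕ} (hr : 0 < r) {s D : ℤ}
    (hD : D ≡ r * s [ZMOD ((8 * r : ℕ) : ℤ)]) : D / r ≡ s [ZMOD 8] := by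
  have hr0 : (r:ℤ) ≠ 0 := by exact_mod_cast hr.ne'
  obtain ⟨t, ht⟩ := Int.modEq_iff_dvd.mp hD.symm
  have hD' : D = r * (s + 8 * t) := by push_cast at ht; linear_combination ht
  rw [hD', Int.mul_ediv_cancel_left _ hr0, Int.modEq_iff_dvd]
  exact ⟨-t, by ring⟩

/-! ## Counting fundamental discriminants in the `2`-adic classes -/

/-- The density of Lemma 21 at `m = 2ᵏ` (`k ≥ 1`) on an admissible class is `8/(π² 2ᵏ)`. -/
theorem ttQuadraticFieldsDensity_two_pow {k : ℕ} (hk : 1 ≤ k) {a : ℤ}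
    (ha : ttLocalFactorTwo a = 1) :
    ttQuadraticFieldsDensity (2 ^ k) a = 8 / (Real.pi ^ 2 * 2 ^ k) := by
  unfold ttQuadraticFieldsDensity
  rw [ha, Nat.primeFactors_prime_pow (by omega) Nat.prime_two, Finset.erase_singleton,
    Finset.prod_empty]
  push_cast
  ring

/-- **Lemma 21 on a class `mod 2ᵏ` inside a `2`-adic type** (`k ≥ 6`, `r 2ʲ = 2ᵏ`,
`b ≡ s (mod 8)`): `|#{D ∈ negFundDiscrs X : D ≡ rs (8r), D/r ≡ b (2ʲ)} − 8X/(π² 2ᵏ)| ≤ C √X`. -/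
theorem abs_card_type_filter_sub_le {r : ℕ} {s : ℤ} (hr : r ∈ ({1, 4, 8} : Finset ℕ))
    (hs : s ∈ ({1, 3, 5, 7} : Finset ℤ)) (he : ttLocalFactorTwo (r * s) = 1) {j k : ℕ}
    (hk : 6 ≤ k) (hrj : r * 2 ^ j = 2 ^ k) {b : ℤ} (hb : b ≡ s [ZMOD 8]) :
    ∃ C : ℝ, ∀ X : ℕ, 1 ≤ X →
      |((((negFundDiscrs X).filter (fun D => D ≡ r * s [ZMOD ((8 * r : ℕ) : ℤ)])).filter
          (fun D => D / r ≡ b [ZMOD ((2 ^ j : ℕ) : ℤ)])).card : ℝ) - 8 / (Real.pi ^ 2 * 2 ^ k) * X|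
        ≤ C * Real.sqrt X := by
  obtain ⟨hr0, -, -, -⟩ := type_arith hr hs
  have hj : 3 ≤ j := three_le_of_mul_two_pow_eq hr hk hrj
  obtain ⟨C, hC⟩ := tt_count_quadraticFields_progression_holds (2 ^ k) ((r : ℤ) * b)
    ((pow_dvd_pow 2 hk).trans (by norm_num))
  refine ⟨C, fun X hX => ?_⟩
  have h := (hC X hX).1
  rw [← hrj, filter_modEq_mul_eq_filter_type hr0 s hj hb, hrj,
    ttQuadraticFieldsDensity_two_pow (by omega) (ttLocalFactorTwo_mul_eq_one_of_modEq hr hs he hb)]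
    at h
  push_cast at h ⊢
  exact h

/-- **The number of discriminants of a `2`-adic type**: for an admissible `(r, s)`,
`|#{D ∈ negFundDiscrs X : D ≡ rs (mod 8r)} − X/(r π²)| ≤ C √X` (the class `rs (mod 8r)` is the
union of the `8/r` admissible classes `rs + 8 r i (mod 64)`, each of density `1/(8π²)`). -/
theorem abs_card_type_sub_le {r : ℕ} {s : ℤ} (hr : r ∈ ({1, 4, 8} : Finset ℕ))
    (hs : s ∈ ({1, 3, 5, 7} : Finset ℤ)) (he : ttLocalFactorTwo (r * s) = 1) :
    ∃ C : ℝ, ∀ X : ℕ, 1 ≤ X →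
      |(((negFundDiscrs X).filter (fun D => D ≡ r * s [ZMOD ((8 * r : ℕ) : ℤ)])).card : ℝ)
          - 1 / (r * Real.pi ^ 2) * X| ≤ C * Real.sqrt X := by
  obtain ⟨hr0, -, h64, -⟩ := type_arith hr hs
  obtain ⟨q, hq⟩ := h64
  have hq0 : 0 < q := by
    rcases Nat.eq_zero_or_pos q with rfl | h
    · omega
    · exact h
  -- each sub-class `rs + 8 r i (mod 64)` is admissible
  have hsub : ∀ i : ℕ, ∃ C : ℝ, ∀ X : ℕ, 1 ≤ X →
      |((((negFundDiscrs X).filter (fun D => D ≡ r * s + ((8 * r : ℕ) : ℤ) * i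
          [ZMOD ((64 : ℕ) : ℤ)])).card : ℕ) : ℝ) - 1 / (8 * Real.pi ^ 2) * X|
        ≤ C * Real.sqrt X := by
    intro i
    obtain ⟨C, hC⟩ := tt_count_quadraticFields_progression_holds 64
      (r * s + ((8 * r : ℕ) : ℤ) * i) (dvd_refl 64)
    refine ⟨C, fun X hX => ?_⟩
    have h := (hC X hX).1
    have hdens : ttQuadraticFieldsDensity 64 (r * s + ((8 * r : ℕ) : ℤ) * i)
        = 1 / (8 * Real.pi ^ 2) := by
      have he' : ttLocalFactorTwo (r * s + ((8 * r : ℕ) : ℤ) * i) = 1 := by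
        have := ttLocalFactorTwo_mul_eq_one_of_modEq hr hs he (b := s + 8 * i)
          (by rw [Int.ModEq]; simp)
        push_cast
        rw [show (r:ℤ) * s + 8 * r * i = r * (s + 8 * i) by ring]
        exact this
      rw [show (64:ℕ) = 2 ^ 6 by norm_num, ttQuadraticFieldsDensity_two_pow (by norm_num) he']
      ring
    rw [hdens] at h
    exact h
  choose C hC using hsub
  refine ⟨∑ i ∈ Finset.range q, C i, fun X hX => ?_⟩
  have hsplit := sum_filter_modEq_eq_sum_sum_filter_modEq (m := 8 * r) (by omega) hq0
    (negFundDiscrs X) (r * s) (fun _ => (1:ℂ))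
  rw [← hq] at hsplit
  simp only [Finset.sum_const, nsmul_eq_mul, mul_one] at hsplit
  have hsplit' : (((negFundDiscrs X).filter
      (fun D => D ≡ r * s [ZMOD ((8 * r : ℕ) : ℤ)])).card : ℝ)
      = ∑ i ∈ Finset.range q, ((((negFundDiscrs X).filter
          (fun D => D ≡ r * s + ((8 * r : ℕ) : ℤ) * i [ZMOD ((64 : ℕ) : ℤ)])).card : ℕ) : ℝ) := by
    have h := congrArg Complex.re hsplit
    rw [Complex.re_sum] at h
    simpa using h
  have hmain : 1 / (r * Real.pi ^ 2) * (X:ℝ) =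
      ∑ _i ∈ Finset.range q, 1 / (8 * Real.pi ^ 2) * (X:ℝ) := by
    rw [Finset.sum_const, Finset.card_range, nsmul_eq_mul]
    have hq' : (q:ℝ) * r = 8 := by
      have h' : ((8 * r * q : ℕ) : ℝ) = 64 := by exact_mod_cast hq.symm
      push_cast at h'
      linarith
    have hr' : (r:ℝ) ≠ 0 := by exact_mod_cast hr0.ne'
    have h1r : (1:ℝ) / r = q / 8 := by
      rw [div_eq_div_iff hr' (by norm_num : (8:ℝ) ≠ 0)]; linarith
    calc 1 / (r * Real.pi ^ 2) * (X:ℝ) = (1 / r) * (1 / Real.pi ^ 2) * X := by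
          rw [one_div_mul_one_div]
      _ = (q / 8) * (1 / Real.pi ^ 2) * X := by rw [h1r]
      _ = q * (1 / (8 * Real.pi ^ 2) * X) := by ring
  rw [hsplit', hmain, ← Finset.sum_sub_distrib, Finset.sum_mul]
  exact (Finset.abs_sum_le_sum_abs _ _).trans (Finset.sum_le_sum fun i _ => hC i X hX)

/-! ## Character sums over a `2`-adic type -/

/-- **Character sums over the discriminants of a `2`-adic type.** For an admissible `(r, s)`,
`k ≥ 6`, `r 2ʲ = 2ᵏ` and a character `χ (mod 2ʲ)` NOT trivial on the residues `≡ 1 (mod 8)`: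
`‖Σ_{D ∈ negFundDiscrs X, D ≡ rs (8r)} χ(D/r)‖ ≤ C √X` (the discriminants are uniformly
distributed over the classes of `D/r (mod 2ʲ)` above `s (mod 8)` by Lemma 21, and `χ` sums to zero
over that fibre of `ZMod 2ʲ → ZMod 8`). -/
theorem norm_sum_char_type_le {r : ℕ} {s : ℤ} (hr : r ∈ ({1, 4, 8} : Finset ℕ))
    (hs : s ∈ ({1, 3, 5, 7} : Finset ℤ)) (he : ttLocalFactorTwo (r * s) = 1) {j k : ℕ}
    (hk : 6 ≤ k) (hrj : r * 2 ^ j = 2 ^ k) (χ : DirichletCharacter ℂ (2 ^ j)) {u : ℤ}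
    (hu : u % 8 = 1) (hχu : χ ((u : ZMod (2 ^ j))) ≠ 1) :
    ∃ C : ℝ, ∀ X : ℕ, 1 ≤ X →
      ‖∑ D ∈ (negFundDiscrs X).filter (fun D => D ≡ r * s [ZMOD ((8 * r : ℕ) : ℤ)]),
          χ (((D / r : ℤ)) : ZMod (2 ^ j))‖ ≤ C * Real.sqrt X := by
  obtain ⟨hr0, -, -, -⟩ := type_arith hr hs
  have hj : 3 ≤ j := three_le_of_mul_two_pow_eq hr hk hrj
  have h8 : 8 ∣ 2 ^ j := by
    rw [show (8:ℕ) = 2 ^ 3 by norm_num]; exact pow_dvd_pow 2 hj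
  haveI : NeZero (2 ^ j) := ⟨by positivity⟩
  set ψ := ZMod.castHom h8 (ZMod 8) with hψ
  set T : ℕ → Finset ℤ := fun X =>
    (negFundDiscrs X).filter (fun D => D ≡ r * s [ZMOD ((8 * r : ℕ) : ℤ)]) with hT
  set z : ZMod 8 := ((s : ℤ) : ZMod 8) with hz
  -- the fibre classes and their counts
  have hcount : ∀ bb : ZMod (2 ^ j), ψ bb = z → ∃ C : ℝ, ∀ X : ℕ, 1 ≤ X →
      |((((T X).filter (fun D => (((D / r : ℤ)) : ZMod (2 ^ j)) = bb)).card : ℕ) : ℝ)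
          - 8 / (Real.pi ^ 2 * 2 ^ k) * X| ≤ C * Real.sqrt X := by
    intro bb hbb
    have hb : (bb.val : ℤ) ≡ s [ZMOD 8] := by
      have h1 : (((bb.val : ℕ) : ℤ) : ZMod 8) = ((s : ℤ) : ZMod 8) := by
        rw [Int.cast_natCast, ← ZMod.cast_eq_val, ← ZMod.castHom_apply (h := h8)]
        exact hbb
      have h2 := (ZMod.intCast_eq_intCast_iff _ _ _).mp h1
      exact_mod_cast h2
    obtain ⟨C, hC⟩ := abs_card_type_filter_sub_le hr hs he hk hrj hb
    refine ⟨C, fun X hX => ?_⟩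
    have hset : (T X).filter (fun D => (((D / r : ℤ)) : ZMod (2 ^ j)) = bb) =
        (T X).filter (fun D => D / r ≡ (bb.val : ℤ) [ZMOD ((2 ^ j : ℕ) : ℤ)]) := by
      refine Finset.filter_congr fun D _ => ?_
      rw [← ZMod.intCast_eq_intCast_iff, Int.cast_natCast, ZMod.natCast_zmod_val]
    rw [hset]
    exact hC X hX
  have hempty : ∀ bb : ZMod (2 ^ j), ψ bb ≠ z → ∀ X : ℕ,
      (T X).filter (fun D => (((D / r : ℤ)) : ZMod (2 ^ j)) = bb) = ∅ := by
    intro bb hbb X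
    refine Finset.filter_eq_empty_iff.mpr fun D hD hDb => hbb ?_
    rw [← hDb, hψ, map_intCast, hz, ZMod.intCast_eq_intCast_iff]
    rw [hT, Finset.mem_filter] at hD
    exact_mod_cast ediv_modEq_of_mem_type hr0 hD.2
  choose! C hC using hcount
  refine ⟨∑ bb : ZMod (2 ^ j), |C bb|, fun X hX => ?_⟩
  set B := (Finset.univ : Finset (ZMod (2 ^ j))).filter (fun bb => ψ bb = z) with hB
  set N : ZMod (2 ^ j) → ℕ := fun bb =>
    ((T X).filter (fun D => (((D / r : ℤ)) : ZMod (2 ^ j)) = bb)).card with hN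
  -- group the sum by the residue of `D/r`
  have hfib : ∑ D ∈ T X, χ (((D / r : ℤ)) : ZMod (2 ^ j)) =
      ∑ bb : ZMod (2 ^ j), (N bb : ℂ) * χ bb := by
    rw [← Finset.sum_fiberwise' (T X) (fun D : ℤ => (((D / r : ℤ)) : ZMod (2 ^ j)))
      (fun bb => χ bb)]
    refine Finset.sum_congr rfl fun bb _ => ?_
    rw [Finset.sum_const, nsmul_eq_mul]
  have hzero : ∑ bb ∈ B, χ bb = 0 := sum_char_fiber_castHom_eq_zero h8 χ hu hχu z
  have hrewrite : ∑ D ∈ T X, χ (((D / r : ℤ)) : ZMod (2 ^ j)) =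
      ∑ bb ∈ B, (((N bb : ℝ) - 8 / (Real.pi ^ 2 * 2 ^ k) * X : ℝ) : ℂ) * χ bb := by
    rw [hfib]
    have h1 : ∑ bb : ZMod (2 ^ j), (N bb : ℂ) * χ bb = ∑ bb ∈ B, (N bb : ℂ) * χ bb := by
      rw [hB, Finset.sum_filter]
      refine Finset.sum_congr rfl fun bb _ => ?_
      by_cases hbb : ψ bb = z
      · rw [if_pos hbb]
      · rw [if_neg hbb, hN]
        simp only
        rw [hempty bb hbb X, Finset.card_empty, Nat.cast_zero, zero_mul]
    rw [h1]
    have h2 : ∑ bb ∈ B, (((8 / (Real.pi ^ 2 * 2 ^ k) * X : ℝ)) : ℂ) * χ bb = 0 := by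
      rw [← Finset.mul_sum, hzero, mul_zero]
    rw [← sub_zero (∑ bb ∈ B, (N bb : ℂ) * χ bb), ← h2, ← Finset.sum_sub_distrib]
    refine Finset.sum_congr rfl fun bb _ => ?_
    push_cast
    ring
  rw [hrewrite]
  refine (norm_sum_le _ _).trans ?_
  rw [Finset.sum_mul]
  calc ∑ bb ∈ B, ‖((((N bb : ℝ) - 8 / (Real.pi ^ 2 * 2 ^ k) * X : ℝ)) : ℂ) * χ bb‖
      ≤ ∑ bb ∈ B, |C bb| * Real.sqrt X := by
        refine Finset.sum_le_sum fun bb hbb => ?_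
        rw [hB, Finset.mem_filter] at hbb
        have hCb := hC bb hbb.2 X hX
        rw [norm_mul, Complex.norm_real, Real.norm_eq_abs]
        calc _ ≤ (C bb * Real.sqrt X) * 1 :=
              mul_le_mul hCb (DirichletCharacter.norm_le_one χ bb) (norm_nonneg _)
                ((abs_nonneg _).trans hCb)
          _ ≤ |C bb| * Real.sqrt X := by
              rw [mul_one]
              exact mul_le_mul_of_nonneg_right (le_abs_self _) (Real.sqrt_nonneg _)
    _ ≤ ∑ bb : ZMod (2 ^ j), |C bb| * Real.sqrt X :=
        Finset.sum_le_sum_of_subset_of_nonneg (Finset.filter_subset _ _)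
          (fun bb _ _ => by positivity)

end Summit.QuantumAdvantage.QuantumAdvantage.Theorems.ArithStatLadder

end
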